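import Summits.CriticalPhenomena.PercolationContinuityZ3.Theorems.PercNearOneGluingNoHeavyQuantThreeClusterCountReduction
import HarnessLib

/-!
# The implant Ψ_b is injective on the configurations whose root region is the maximum valid split (counting form)

builds on p205010 (kernel theorem, internal audit signed; external expert review pending)

Support file (`--supports stmt-CriticalPhenomena-4575`), seat `prim-quant-p1` (gen 43); memo
`run/shared/lean/prim/quant/prim-quant-p1-g43/FOR-LEAD-Z32-FIBRES.md` §3.8.  No definitions, no named facts, no sorries;
standard axioms.

The second local ingredient of the Hall problem for `R₀` (memo §3.8; the first is the per-depth fibre injection ✓ p623103):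
the IMPLANT towards `b` of p1 g40 (✓ p575478: `K = C_b(C₂)`, `A` = the `C₁`-cluster of `a` avoiding the edges touching `K`,
`Z := C₁ on T(A), C₂ elsewhere`; `C_a(Z) = A ⊔ K`, so `Z ∈ ab|c` as soon as a door `A–K` exists and `c ∉ A`) is NOT decodable in
general — `C_a(Z)` may split in several valid ways (the "petals"/"phantoms" of the p1 g42 memo) — but it IS injective on the
configurations for which `A` is the inclusion-MAXIMUM VALID SPLIT (g42's "P-max" rule):
* a VALID SPLIT of `M = C_a(Z)` (relative to `Z` and the ambient edge set `U`) is a pair `(A', M ∖ A')` with `a ∈ A'`, `b ∉ A'`,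
  `A'` `Z`-connected from `a` inside `A'`, `M ∖ A'` `Z`-connected from `b` inside `M ∖ A'`, every `U`-edge between `A'` and
  `M ∖ A'` in `Z`, and no `U`-edge between `A'` and `b`;
* `implant_split_valid` — the true split `(A, K)` is valid (needs `U ⊆ C₁ ∪ C₂` and no `U`-edge `A–b`, i.e. the separator property
  of `R₀`, ✓ p611947);
* `classCount_implant_max_le` — counting form in a class (`C₁ = I ∪ T`, `C₂ = I ∪ (F ∖ T)`, `U = I ∪ F`): the number of `T`
  with `a ↔ b` in `C₁`, `C₂` separating `b` from `a` and `c`, the `b`-seal failing, no `U`-edge from `A` to `b`, and EVERY valid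
  split's `a`-side contained in `A`, is at most `#{T : I ∪ T ∈ ab|c}`.
So in the SDR problem of the memo each Ψ_b-class (= the nested chain of valid splits of one image) owns its image through its
maximum; symmetric statement for Ψ_c by exchanging `b` and `c`.
-/

namespace Summit.CriticalPhenomena.PercolationContinuityZ3.Theorems

open Finset Literature.Probability.Percolation Literature.Probability.Percolation.DecisionTree

variable {V : Type*}

namespace ThreeClusterSwap

section Implant

variable (C₁ C₂ U : Set (Sym2 V)) (a b : V) (K A : Set V) (TK TA Z : Set (Sym2 V))

/-- A door exists: if `a ↔ b` in `C₁` and `b ∈ K` while `a ∉ K`, some `C₁`-open edge joins the avoiding cluster `A` to `K`.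
[this work] -/
theorem implant_door (hTK : TK = {e | ∃ v ∈ K, v ∈ e}) (hA : A = {v | (openGraph (C₁ \ TK)).Reachable a v})
    (ha : a ∉ K) (hb : b ∈ K) (hab : (openGraph C₁).Reachable a b) :
    ∃ x ∈ A, ∃ y ∈ K, s(x, y) ∈ C₁ ∧ x ≠ y := by
  by_contra hno
  push Not at hno
  have haA : a ∈ A := by rw [hA]; exact SimpleGraph.Reachable.refl a
  -- without a door, `C₁`-reachability from `a` never leaves `A`
  have key := reachable_invariant (P := fun x => x ∈ A) hab haA (by
    intro u w hu huw
    rw [openGraph_adj] at huw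
    have hwK : w ∉ K := fun hwK => huw.2 (hno u hu w hwK huw.1)
    have huK : u ∉ K := avoid_disjoint C₁ a K A TK hTK hA ha hu
    have hnt : s(u, w) ∉ TK := by
      rw [hTK]; rintro ⟨v, hvK, hv⟩
      rcases Sym2.mem_iff.1 hv with rfl | rfl
      · exact huK hvK
      · exact hwK hvK
    rw [hA] at hu ⊢
    have he : s(u, w) ∈ C₁ \ TK := ⟨huw.1, hnt⟩
    exact hu.trans ((openGraph_adj _ u w).2 ⟨he, huw.2⟩).reachable)
  exact avoid_disjoint C₁ a K A TK hTK hA ha key hb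

/-- **The true split is valid.**  With `K = C_b(C₂) ∌ a`, `A` the `C₁`-cluster of `a` avoiding `T(K)`, `Z = C₁ on T(A), C₂
elsewhere`, and `U ⊆ C₁ ∪ C₂` the ambient edges: `A` is `Z`-connected from `a` inside `A`, `K` is `Z`-connected from `b` inside
`K`, and every `U`-edge between `A` and `K` is `Z`-open. [this work] -/
theorem implant_split_valid (hK : K = {v | (openGraph C₂).Reachable b v}) (hTK : TK = {e | ∃ v ∈ K, v ∈ e})
    (hA : A = {v | (openGraph (C₁ \ TK)).Reachable a v}) (hTA : TA = {e | ∃ v ∈ A, v ∈ e})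
    (hZ : Z = (C₁ ∩ TA) ∪ (C₂ \ TA)) (hU : U ⊆ C₁ ∪ C₂) (ha : a ∉ K) :
    (∀ v ∈ A, (openGraph (Z ∩ {e | ∀ w ∈ e, w ∈ A})).Reachable a v) ∧
    (∀ v ∈ K, (openGraph (Z ∩ {e | ∀ w ∈ e, w ∈ K})).Reachable b v) ∧
    (∀ x ∈ A, ∀ y ∈ K, s(x, y) ∈ U → s(x, y) ∈ Z) := by
  have haA : a ∈ A := by rw [hA]; exact SimpleGraph.Reachable.refl a
  have hbK : b ∈ K := by rw [hK]; exact SimpleGraph.Reachable.refl b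
  refine ⟨?_, ?_, ?_⟩
  · intro v hv
    have hv' : (openGraph (C₁ \ TK)).Reachable a v := by rw [hA] at hv; exact hv
    refine (reachable_transfer (G' := openGraph (Z ∩ {e | ∀ w ∈ e, w ∈ A})) (P := fun x => x ∈ A) hv' haA ?_).1
    intro u w hu huw
    rw [openGraph_adj] at huw
    have hwA : w ∈ A := by rw [hA] at hu ⊢; exact hu.trans ((openGraph_adj _ u w).2 huw).reachable
    refine ⟨hwA, (openGraph_adj _ u w).2 ⟨⟨?_, ?_⟩, huw.2⟩⟩
    · rw [hZ]; exact Or.inl ⟨huw.1.1, by rw [hTA]; exact ⟨u, hu, Sym2.mem_mk_left u w⟩⟩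
    · intro x hx
      rcases Sym2.mem_iff.1 hx with rfl | rfl
      · exact hu
      · exact hwA
  · intro v hv
    have hv' : (openGraph C₂).Reachable b v := by rw [hK] at hv; exact hv
    refine (reachable_transfer (G' := openGraph (Z ∩ {e | ∀ w ∈ e, w ∈ K})) (P := fun x => x ∈ K) hv' hbK ?_).1
    intro u w hu huw
    rw [openGraph_adj] at huw
    have hwK : w ∈ K := by rw [hK] at hu ⊢; exact hu.trans ((openGraph_adj _ u w).2 huw).reachable
    have hnA : s(u, w) ∉ TA := by
      rw [hTA]; rintro ⟨x, hxA, hx⟩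
      have hxK : x ∉ K := avoid_disjoint C₁ a K A TK hTK hA ha hxA
      rcases Sym2.mem_iff.1 hx with rfl | rfl
      · exact hxK hu
      · exact hxK hwK
    refine ⟨hwK, (openGraph_adj _ u w).2 ⟨⟨?_, ?_⟩, huw.2⟩⟩
    · rw [hZ]; exact Or.inr ⟨huw.1, hnA⟩
    · intro x hx
      rcases Sym2.mem_iff.1 hx with rfl | rfl
      · exact hu
      · exact hwK
  · intro x hx y hy hxy
    have hxK : x ∉ K := avoid_disjoint C₁ a K A TK hTK hA ha hx
    -- a `U`-edge from outside `K` into the `C₂`-cluster `K` is `C₂`-closed, hence `C₁`-open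
    have h1 : s(x, y) ∈ C₁ := by
      rcases hU hxy with h | h
      · exact h
      · exfalso
        by_cases hne : x = y
        · exact hxK (hne ▸ hy)
        · apply hxK
          rw [hK] at hy ⊢
          exact hy.trans ((openGraph_adj C₂ y x).2 ⟨by rw [Sym2.eq_swap]; exact h, fun h' => hne h'.symm⟩).reachable
    rw [hZ]; exact Or.inl ⟨h1, by rw [hTA]; exact ⟨x, hx, Sym2.mem_mk_left x y⟩⟩

end Implant

/-! ### Counting form: Ψ_b is injective on the maximum-split configurations -/

section Count

variable [Fintype V] [DecidableEq V]

open scoped Classical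

/-- **Ψ_b on maximum-split configurations injects into `ab|c`.**  In a class (`C₁ = I ∪ T`, `C₂ = I ∪ (F ∖ T)`, `U = I ∪ F`),
let `K = C_b(C₂)`, `A` = the `C₁`-cluster of `a` avoiding the edges touching `K`, `Z = C₁ on T(A), C₂ elsewhere`.  Count the `T`
with: `a ↔ b` in `C₁`; `b ↮ a` and `b ↮ c` in `C₂`; `a ↮ c` in `C₁` off `T(K)` (the `b`-seal fails, so `c ∉ A`); no `U`-edge from
`A` to `b`; and MAXIMALITY: every `A' ⊆ V` with `a ∈ A'`, `b ∉ A'`, `A' ⊆ C_a(Z)`, `A'` `Z`-connected from `a` inside `A'`,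
`C_a(Z) ∖ A'` `Z`-connected from `b` inside itself, all `U`-edges between `A'` and `C_a(Z) ∖ A'` in `Z`, and no `U`-edge `A'–b`,
satisfies `A' ⊆ A`.  Their number is at most `#{T : I ∪ T ∈ ab|c}`: the image `Z` lies in `ab|c` (✓ p575478 implant lemmas with
`K = C_b(C₂)`), and `A` is recovered from `Z` as the union of the `a`-sides of the valid splits of `C_a(Z)`. [this work] -/
theorem classCount_implant_max_le (I F : Finset (Sym2 V)) (a b c : V) :
    ((F.powerset.filter fun T =>
        (openGraph (↑(I ∪ T) : Set (Sym2 V))).Reachable a b ∧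
        ¬ (openGraph (↑(I ∪ (F \ T)) : Set (Sym2 V))).Reachable b a ∧
        ¬ (openGraph (↑(I ∪ (F \ T)) : Set (Sym2 V))).Reachable b c ∧
        ¬ (openGraph ((↑(I ∪ T) : Set (Sym2 V)) \
            {e | ∃ v ∈ {v | (openGraph (↑(I ∪ (F \ T)) : Set (Sym2 V))).Reachable b v}, v ∈ e})).Reachable a c ∧
        (∀ x ∈ ({v | (openGraph ((↑(I ∪ T) : Set (Sym2 V)) \
            {e | ∃ v ∈ {v | (openGraph (↑(I ∪ (F \ T)) : Set (Sym2 V))).Reachable b v}, v ∈ e})).Reachable a v} : Set V),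
          s(x, b) ∉ (↑(I ∪ F) : Set (Sym2 V))) ∧
        (∀ A' : Set V,
          let Z : Set (Sym2 V) :=
            ((↑(I ∪ T) : Set (Sym2 V)) ∩ {e | ∃ v ∈ {v | (openGraph ((↑(I ∪ T) : Set (Sym2 V)) \
              {e | ∃ v ∈ {v | (openGraph (↑(I ∪ (F \ T)) : Set (Sym2 V))).Reachable b v}, v ∈ e})).Reachable a v}, v ∈ e}) ∪
            ((↑(I ∪ (F \ T)) : Set (Sym2 V)) \ {e | ∃ v ∈ {v | (openGraph ((↑(I ∪ T) : Set (Sym2 V)) \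
              {e | ∃ v ∈ {v | (openGraph (↑(I ∪ (F \ T)) : Set (Sym2 V))).Reachable b v}, v ∈ e})).Reachable a v}, v ∈ e})
          (a ∈ A' ∧ b ∉ A' ∧ (∀ v ∈ A', (openGraph Z).Reachable a v) ∧
            (∀ v ∈ A', (openGraph (Z ∩ {e | ∀ w ∈ e, w ∈ A'})).Reachable a v) ∧
            (∀ v, (openGraph Z).Reachable a v → v ∉ A' →
              (openGraph (Z ∩ {e | ∀ w ∈ e, (openGraph Z).Reachable a w ∧ w ∉ A'})).Reachable b v) ∧
            (∀ x ∈ A', ∀ y, (openGraph Z).Reachable a y → y ∉ A' → s(x, y) ∈ (↑(I ∪ F) : Set (Sym2 V)) → s(x, y) ∈ Z) ∧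
            (∀ x ∈ A', s(x, b) ∉ (↑(I ∪ F) : Set (Sym2 V)))) →
          A' ⊆ {v | (openGraph ((↑(I ∪ T) : Set (Sym2 V)) \
            {e | ∃ v ∈ {v | (openGraph (↑(I ∪ (F \ T)) : Set (Sym2 V))).Reachable b v}, v ∈ e})).Reachable a v})).card) ≤
    (F.powerset.filter fun T =>
        (openGraph (↑(I ∪ T) : Set (Sym2 V))).Reachable a b ∧
          ¬ (openGraph (↑(I ∪ T) : Set (Sym2 V))).Reachable a c).card := by
  -- data of the map
  let X : Finset (Sym2 V) → Set (Sym2 V) := fun T => (↑(I ∪ T) : Set (Sym2 V))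
  let Xb : Finset (Sym2 V) → Set (Sym2 V) := fun T => (↑(I ∪ (F \ T)) : Set (Sym2 V))
  let Uu : Set (Sym2 V) := (↑(I ∪ F) : Set (Sym2 V))
  let K : Finset (Sym2 V) → Set V := fun T => {v | (openGraph (Xb T)).Reachable b v}
  let TK : Finset (Sym2 V) → Set (Sym2 V) := fun T => {e | ∃ v ∈ K T, v ∈ e}
  let A : Finset (Sym2 V) → Set V := fun T => {v | (openGraph (X T \ TK T)).Reachable a v}
  let TA : Finset (Sym2 V) → Set (Sym2 V) := fun T => {e | ∃ v ∈ A T, v ∈ e}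
  let Zf : Finset (Sym2 V) → Set (Sym2 V) := fun T => (X T ∩ TA T) ∪ (Xb T \ TA T)
  let G : Finset (Sym2 V) → Finset (Sym2 V) := fun T => F.filter fun e => e ∈ (TA T)ᶜ
  let f : Finset (Sym2 V) → Finset (Sym2 V) := fun T => (T \ G T) ∪ ((F \ T) ∩ G T)
  have hG : ∀ T e, e ∈ G T ↔ e ∈ F ∧ e ∈ (TA T)ᶜ := fun T e => Finset.mem_filter
  have hcoe : ∀ T ⊆ F, (↑(I ∪ f T) : Set (Sym2 V)) = Zf T := by
    intro T hT
    rw [coe_union_flipOn I F T (G T) (TA T)ᶜ hT (hG T)]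
    ext e
    simp only [Set.mem_union, Set.mem_inter_iff, Set.mem_sdiff, Set.mem_compl_iff, X, Xb, Zf]
    tauto
  have hU : ∀ T ⊆ F, Uu ⊆ X T ∪ Xb T := by
    intro T hT e he
    simp only [Uu, X, Xb, Finset.coe_union, Finset.coe_sdiff, Set.mem_union, Set.mem_sdiff, Finset.mem_coe] at he ⊢
    rcases he with h | h
    · exact Or.inl (Or.inl h)
    · by_cases heT : e ∈ T
      · exact Or.inl (Or.inr heT)
      · exact Or.inr (Or.inr ⟨h, heT⟩)
  -- the valid-split predicate, as in the statement (with `Z` substituted)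
  let Valid : Set (Sym2 V) → Set V → Prop := fun Z A' =>
    a ∈ A' ∧ b ∉ A' ∧ (∀ v ∈ A', (openGraph Z).Reachable a v) ∧
      (∀ v ∈ A', (openGraph (Z ∩ {e | ∀ w ∈ e, w ∈ A'})).Reachable a v) ∧
      (∀ v, (openGraph Z).Reachable a v → v ∉ A' →
        (openGraph (Z ∩ {e | ∀ w ∈ e, (openGraph Z).Reachable a w ∧ w ∉ A'})).Reachable b v) ∧
      (∀ x ∈ A', ∀ y, (openGraph Z).Reachable a y → y ∉ A' → s(x, y) ∈ Uu → s(x, y) ∈ Z) ∧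
      (∀ x ∈ A', s(x, b) ∉ Uu)
  -- key facts for a domain element: a door, `C_a(Z) = A ∪ K`, and validity of the true split
  have hfacts : ∀ T, T ⊆ F → (openGraph (X T)).Reachable a b → ¬ (openGraph (Xb T)).Reachable b a →
      ¬ (openGraph (Xb T)).Reachable b c → ¬ (openGraph (X T \ TK T)).Reachable a c →
      (∀ x ∈ A T, s(x, b) ∉ Uu) →
      ({v | (openGraph (Zf T)).Reachable a v} = A T ∪ K T) ∧ Valid (Zf T) (A T) ∧
        (openGraph (Zf T)).Reachable a b ∧ ¬ (openGraph (Zf T)).Reachable a c := by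
    intro T hT hab hba hbc hac hAb
    have haK : a ∉ K T := fun h => hba h
    have hbK : b ∈ K T := SimpleGraph.Reachable.refl b
    obtain ⟨x, hx, y, hy, hxy, hne⟩ := implant_door (X T) a b (K T) (A T) (TK T) rfl rfl haK hbK hab
    have hM : {v | (openGraph (Zf T)).Reachable a v} = A T ∪ K T :=
      implant_cluster_eq (X T) (Xb T) a b (K T) (A T) (TK T) (TA T) (Zf T) rfl rfl rfl rfl rfl haK hx hy hxy hne
    obtain ⟨hvA, hvK, hcross⟩ := implant_split_valid (X T) (Xb T) Uu a b (K T) (A T) (TK T) (TA T) (Zf T)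
      rfl rfl rfl rfl rfl (hU T hT) haK
    have haA : a ∈ A T := SimpleGraph.Reachable.refl a
    have hAK : ∀ v ∈ A T, v ∉ K T := fun v hv => avoid_disjoint (X T) a (K T) (A T) (TK T) rfl rfl haK hv
    -- the complement of `A` inside `C_a(Z)` is exactly `K`
    have hcomp : ∀ w, ((openGraph (Zf T)).Reachable a w ∧ w ∉ A T) ↔ w ∈ K T := by
      intro w
      constructor
      · rintro ⟨hw, hwA⟩
        have : w ∈ A T ∪ K T := by rw [← hM]; exact hw
        exact this.resolve_left hwA
      · intro hwK
        refine ⟨?_, fun hwA => hAK w hwA hwK⟩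
        have : w ∈ A T ∪ K T := Or.inr hwK
        rw [← hM] at this; exact this
    have hsetK : {e : Sym2 V | ∀ w ∈ e, (openGraph (Zf T)).Reachable a w ∧ w ∉ A T} = {e | ∀ w ∈ e, w ∈ K T} := by
      ext e
      simp only [Set.mem_setOf_eq]
      constructor
      · intro h w hw; exact (hcomp w).1 (h w hw)
      · intro h w hw; exact (hcomp w).2 (h w hw)
    refine ⟨hM, ⟨haA, fun hbA => hAK b hbA hbK, ?_, hvA, ?_, ?_, hAb⟩, ?_, ?_⟩
    · intro v hv
      have : v ∈ A T ∪ K T := Or.inl hv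
      rw [← hM] at this; exact this
    · intro v hv hvA
      rw [hsetK]
      exact hvK v ((hcomp v).1 ⟨hv, hvA⟩)
    · intro x' hx' y' hy' hyA' hU'
      exact hcross x' hx' y' ((hcomp y').1 ⟨hy', hyA'⟩) hU'
    · have : b ∈ A T ∪ K T := Or.inr hbK
      rw [← hM] at this; exact this
    · intro hZac
      have : c ∈ A T ∪ K T := by rw [← hM]; exact hZac
      rcases this with hcA | hcK
      · exact hac hcA
      · exact hbc hcK
  refine Finset.card_le_card_of_injOn f (fun T hT => ?_) (fun T₁ h₁ T₂ h₂ heq => ?_)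
  · rw [Finset.mem_coe, Finset.mem_filter, Finset.mem_powerset] at hT ⊢
    obtain ⟨hTF, hab, hba, hbc, hac, hAb, -⟩ := hT
    obtain ⟨-, -, hZab, hZac⟩ := hfacts T hTF hab hba hbc hac hAb
    refine ⟨flipOn_subset F (G T) T hTF, ?_, ?_⟩
    · rw [hcoe T hTF]; exact hZab
    · rw [hcoe T hTF]; exact hZac
  · rw [Finset.coe_filter] at h₁ h₂
    have hT₁ : T₁ ⊆ F := Finset.mem_powerset.1 h₁.1
    have hT₂ : T₂ ⊆ F := Finset.mem_powerset.1 h₂.1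
    obtain ⟨-, hab₁, hba₁, hbc₁, hac₁, hAb₁, hmax₁⟩ := h₁
    obtain ⟨-, hab₂, hba₂, hbc₂, hac₂, hAb₂, hmax₂⟩ := h₂
    obtain ⟨hM₁, hV₁, -, -⟩ := hfacts T₁ hT₁ hab₁ hba₁ hbc₁ hac₁ hAb₁
    obtain ⟨hM₂, hV₂, -, -⟩ := hfacts T₂ hT₂ hab₂ hba₂ hbc₂ hac₂ hAb₂
    have hZeq : Zf T₁ = Zf T₂ := by rw [← hcoe T₁ hT₁, ← hcoe T₂ hT₂, heq]
    -- maximality both ways gives `A T₁ = A T₂`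
    have hV₂' : Valid (Zf T₁) (A T₂) := by rw [hZeq]; exact hV₂
    have hV₁' : Valid (Zf T₂) (A T₁) := by rw [← hZeq]; exact hV₁
    have h12 : A T₂ ⊆ A T₁ := hmax₁ (A T₂) hV₂'
    have h21 : A T₁ ⊆ A T₂ := hmax₂ (A T₁) hV₁'
    have hAeq : A T₁ = A T₂ := Set.Subset.antisymm h21 h12
    have hTAeq : TA T₁ = TA T₂ := by
      change {e | ∃ v ∈ A T₁, v ∈ e} = {e | ∃ v ∈ A T₂, v ∈ e}
      rw [hAeq]
    have hGeq : G T₁ = G T₂ := by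
      ext e
      rw [hG, hG, hTAeq]
    have e1 : T₁ = ((f T₁ \ G T₁) ∪ ((F \ f T₁) ∩ G T₁)) := (flipOn_flipOn F (G T₁) T₁ hT₁).symm
    have e2 : T₂ = ((f T₂ \ G T₂) ∪ ((F \ f T₂) ∩ G T₂)) := (flipOn_flipOn F (G T₂) T₂ hT₂).symm
    rw [e1, e2, heq, hGeq]

end Count

end ThreeClusterSwap

end Summit.CriticalPhenomena.PercolationContinuityZ3.Theorems
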